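import Mathlib
import Literature.Probability.Percolation.DiagonalStripTransferRecursion
import Literature.Probability.Percolation.DiagonalStripLumping
import Literature.Probability.Percolation.DiagonalStripGenericSimplicity
import HarnessLib

/-!
# The special point `P_i` of the hyperplane `z_{i+1} = q z_i`: the eigenvalue `1` of `t` is simple there

Topic `Literature/Probability/Percolation`. Ikhlef–Ponsaing (J. Stat. Phys. 149 (2012),
arXiv:1202.5476) §3.4 derive the recursion (25), `Ψ_L(z_{i+1} = q z_i) ∝ φ_i Ψ_{L-2}(ẑ)`, from
Lemma 3.3 and "since the ground state is unique". On the hyperplane `H_i = {z_{i+1} = q z_i}` the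
uniqueness is a genuinely new statement (the generic simplicity of
`DiagonalStripGenericSimplicity.lean` lives on the whole rapidity space); this file proves its
closed-point half: at the point `P_i ∈ H_i` given by `w = w₀` (`w₀² = -q`), `z_i = ζ₀` (`ζ₀² = -q²`),
`z_{i+1} = q ζ₀`, all other `z_k = 1`,

* the four tiles on the lines `i, i+1` are deterministic (`ipRowWeight_hypPt_row0/row1`: in row `0`
  open iff `i` is even, in row `1` open iff `i` is odd) and all other tiles have weight `1/2`
  (`ipRowWeight_hypPt_of_ne`; `ipWtA_homog`, `ipWtB_homog`: `A(1/w₀) = B(1/w₀) = 1/2`);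
* hence `t(P_i)` leads from EVERY state into the inserted states `φ_i(·)`
  (`exists_cpInsIso_of_ipTransferMatrixW_hypPt_ne_zero`, `exists_cpInsDup_of_…`), and on them it is
  conjugate by Lemma 3.3 to the small transfer matrix at `ẑ(P_i) = (1, …, 1)`, i.e. to the
  percolation-point kernel `t(½)` (`ipTransferMatrixW_zHat_hypPt`), whose fixed space is the line of
  `π̄` (`DiagonalStripGenericSimplicity.lean`);
* so every row vector fixed by `t(P_i)` is a multiple of the push-forward of `π̄`
  (`ipTMatPt_vecMul_line_even/odd`, through the abstract contraction/expansion lemmas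
  `fixed_contract`, `fixed_line_of_contract`), and the adjugate of `t(P_i) - 1` is nonzero.

The generic half (rank semicontinuity from `P_i` to the function field of `H_i`) and the recursion
(25) up to its scalar are in `DiagonalStripHyperplaneRecursion.lean`.

## References

* Y. Ikhlef, A. K. Ponsaing, *Finite-size left-passage probability in percolation*, J. Stat. Phys.
  149 (2012) 10–36, arXiv:1202.5476, §3.4 (eq. (25)) and Lemma 3.3. [IkhlefPonsaing2012]
-/

namespace Literature.Probability.Percolation

open Finset Literature.Probability.LatticeModels Literature.Probability.LatticeModels.TemperleyLieb

/-! ### The special point `P_i` of the hyperplane `z_{i+1} = q z_i`: tile weights -/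

section SpecialWeights

variable {K : Type*} [Field K]

/-- `A(x) = 0` when `x² = q` (`[q x] = 0` as `(qx)² = q³ = 1`). [folklore] -/
theorem ipWtA_of_sq_eq_q {q x : K} (hq : q ^ 2 + q + 1 = 0) (hx : x ^ 2 = q) : ipWtA q x = 0 := by
  have hq3 : q ^ 3 = 1 := by linear_combination (q - 1) * hq
  have h1 : (q * x) ^ 2 = 1 := by rw [mul_pow, hx]; linear_combination hq3
  have hinv : (q * x)⁻¹ = q * x := inv_eq_of_mul_eq_one_right (by rw [← sq, h1])
  have hbr : qbr (q * x) = 0 := by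
    unfold qbr
    rw [hinv, sub_self]
  unfold ipWtA
  rw [hbr, zero_div]

/-- `B(x) = 0` when `x² = 1`. [folklore] -/
theorem ipWtB_of_sq_eq_one {q x : K} (hx : x ^ 2 = 1) : ipWtB q x = 0 := by
  have hinv : x⁻¹ = x := inv_eq_of_mul_eq_one_right (by rw [← sq, hx])
  have hbr : qbr x = 0 := by
    unfold qbr
    rw [hinv, sub_self]
  unfold ipWtB
  rw [hbr, zero_div]

/-- `B(x) = 1` when `x² = q`, away from the pole. [folklore] -/
theorem ipWtB_of_sq_eq_q {q x : K} (hx : x ^ 2 = q) (hden : qbr (q / x) ≠ 0) : ipWtB q x = 1 := by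
  have hx0 : x ≠ 0 := by
    rintro rfl
    apply hden; simp [qbr]
  have hq0 : q ≠ 0 := by rw [← hx]; exact pow_ne_zero 2 hx0
  unfold ipWtB
  rw [div_eq_one_iff_eq hden]
  unfold qbr
  rw [inv_div, sub_eq_sub_iff_sub_eq_sub]
  field_simp
  linear_combination (q + 1) * hx

/-- `A(x) = 1` when `x² = 1`, away from the pole. [folklore] -/
theorem ipWtA_of_sq_eq_one {q x : K} (hx : x ^ 2 = 1) (hden : qbr (q / x) ≠ 0) : ipWtA q x = 1 := by
  have hxinv : x⁻¹ = x := inv_eq_of_mul_eq_one_right (by rw [← sq, hx])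
  unfold ipWtA
  rw [div_eq_one_iff_eq hden]
  unfold qbr
  rw [inv_div, mul_inv, div_eq_mul_inv q x, hxinv]
  ring

/-- **`A(1/w₀) = 1/2` at the percolation point `w₀² = -q`.** [cite: IkhlefPonsaing2012, §3.1] -/
theorem ipWtA_homog {q w₀ : K} (hq : q ^ 2 + q + 1 = 0) (hw : w₀ ^ 2 = -q) (h2 : (2 : K) ≠ 0) :
    ipWtA q w₀⁻¹ = 1 / 2 := by
  have hq0 : q ≠ 0 := q_ne_zero_of_quad hq
  have hw0 : w₀ ≠ 0 := by
    rintro rfl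
    apply hq0; linear_combination hw
  have hq3 : q ^ 3 = 1 := by linear_combination (q - 1) * hq
  -- numerator and denominator brackets, cleared of denominators
  have hnum : qbr (q * w₀⁻¹) * (q * w₀) = q ^ 2 - w₀ ^ 2 := by
    unfold qbr; rw [mul_inv, inv_inv, sub_mul]
    calc q * w₀⁻¹ * (q * w₀) - q⁻¹ * w₀ * (q * w₀) = q * q * (w₀⁻¹ * w₀) - (q⁻¹ * q) * (w₀ * w₀) := by ring
      _ = q ^ 2 - w₀ ^ 2 := by rw [inv_mul_cancel₀ hw0, inv_mul_cancel₀ hq0]; ring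
  have hden : qbr (q / w₀⁻¹) * (q * w₀) = q ^ 2 * w₀ ^ 2 - 1 := by
    unfold qbr; rw [div_inv_eq_mul, sub_mul]
    calc q * w₀ * (q * w₀) - (q * w₀)⁻¹ * (q * w₀) = q * w₀ * (q * w₀) - 1 := by
          rw [inv_mul_cancel₀ (mul_ne_zero hq0 hw0)]
      _ = q ^ 2 * w₀ ^ 2 - 1 := by ring
  have hden' : qbr (q / w₀⁻¹) ≠ 0 := by
    intro h
    rw [h, zero_mul, hw] at hden
    apply h2
    linear_combination hden - hq3
  have hqw : q * w₀ ≠ 0 := mul_ne_zero hq0 hw0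
  have h1 : q ^ 2 - w₀ ^ 2 = -1 := by rw [hw]; linear_combination hq
  have h2' : q ^ 2 * w₀ ^ 2 - 1 = -2 := by rw [hw]; linear_combination -hq3
  unfold ipWtA
  rw [div_eq_div_iff hden' h2, eq_comm]
  calc 1 * qbr (q / w₀⁻¹) = qbr (q / w₀⁻¹) * (q * w₀) / (q * w₀) := by field_simp
    _ = -2 / (q * w₀) := by rw [hden, h2']
    _ = (-1) * 2 / (q * w₀) := by ring
    _ = qbr (q * w₀⁻¹) * (q * w₀) * 2 / (q * w₀) := by rw [hnum, h1]
    _ = qbr (q * w₀⁻¹) * 2 := by field_simp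

/-- **`B(1/w₀) = 1/2` at `w₀² = -q`.** [cite: IkhlefPonsaing2012, §3.1] -/
theorem ipWtB_homog {q w₀ : K} (hq : q ^ 2 + q + 1 = 0) (hw : w₀ ^ 2 = -q) (h2 : (2 : K) ≠ 0) :
    ipWtB q w₀⁻¹ = 1 / 2 := by
  have hA := ipWtA_homog hq hw h2
  have hden' : qbr (q / w₀⁻¹) ≠ 0 := by
    intro h
    unfold ipWtA at hA
    rw [h, div_zero, eq_comm, one_div, inv_eq_zero] at hA
    exact h2 hA
  have hAB := ipWtA_add_ipWtB hq hden'
  rw [hA] at hAB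
  have : ipWtB q w₀⁻¹ = 1 - 1 / 2 := by linear_combination hAB
  rw [this]
  field_simp
  norm_num

end SpecialWeights

/-! ### The special point `P_i`: rapidities and row weights -/

section HypPoint

variable {K : Type*} [Field K]

/-- **The special point `P_i` of the hyperplane `z_{i+1} = q z_i`**: `w = w₀`, `z_i = ζ₀`,
`z_{i+1} = q ζ₀`, all other `z_k = 1` (with `w₀² = -q`, `ζ₀² = -q²` the four tiles on the lines
`i, i+1` are deterministic and all other tiles have weight `1/2`). [cite: IkhlefPonsaing2012, §3.4] -/
def ipHypPt (q w₀ ζ₀ : K) (i : ℕ) : ℕ → K :=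
  fun k => if k = i then ζ₀ else if k = i + 1 then q * ζ₀ else if k = 0 then w₀ else 1

/-- Value at level `i`. [folklore] -/
theorem ipHypPt_self (q w₀ ζ₀ : K) (i : ℕ) : ipHypPt q w₀ ζ₀ i i = ζ₀ := by simp [ipHypPt]

/-- Value at level `i+1`. [folklore] -/
theorem ipHypPt_succ (q w₀ ζ₀ : K) (i : ℕ) : ipHypPt q w₀ ζ₀ i (i + 1) = q * ζ₀ := by simp [ipHypPt]

/-- Value at the other positive levels. [folklore] -/
theorem ipHypPt_of_ne (q w₀ ζ₀ : K) {i k : ℕ} (hk0 : k ≠ 0) (hki : k ≠ i) (hki' : k ≠ i + 1) :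
    ipHypPt q w₀ ζ₀ i k = 1 := by simp [ipHypPt, hk0, hki, hki']

/-- `P_i` lies on the hyperplane. [folklore] -/
theorem ipHypPt_hyp (q w₀ ζ₀ : K) (i : ℕ) : ipHypPt q w₀ ζ₀ i (i + 1) = q * ipHypPt q w₀ ζ₀ i i := by
  rw [ipHypPt_self, ipHypPt_succ]

/-- `[q/x] ≠ 0` when `x² = q ≠ 1`. [folklore] -/
theorem qbr_div_ne_zero_of_sq_eq_q {q x : K} (hq : q ^ 2 + q + 1 = 0) (hq1 : q ≠ 1) (hx : x ^ 2 = q) :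
    qbr (q / x) ≠ 0 := by
  have hq0 : q ≠ 0 := q_ne_zero_of_quad hq
  have hx0 : x ≠ 0 := fun h => hq0 (by rw [← hx, h]; ring)
  have hxx : x * x = q := by rw [← sq, hx]
  have key : qbr (q / x) * x = q - 1 := by
    unfold qbr
    rw [inv_div, sub_mul, div_mul_cancel₀ _ hx0, div_mul_eq_mul_div, hxx, div_self hq0]
  intro h
  rw [h, zero_mul] at key
  exact hq1 (by linear_combination -key)

/-- `[q/x] ≠ 0` when `x² = 1` (`q² ≠ 1` at `q² + q + 1 = 0`, `q ≠ 1`). [folklore] -/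
theorem qbr_div_ne_zero_of_sq_eq_one {q x : K} (hq : q ^ 2 + q + 1 = 0) (hq1 : q ≠ 1) (hx : x ^ 2 = 1) :
    qbr (q / x) ≠ 0 := by
  have hq0 : q ≠ 0 := q_ne_zero_of_quad hq
  have hx0 : x ≠ 0 := fun h => by rw [h] at hx; norm_num at hx
  have hxx : x * x = 1 := by rw [← sq, hx]
  have hqq : q ^ 2 ≠ 1 := by
    intro h
    have h3 : q = -2 := by linear_combination hq - h
    apply hq1
    rw [h3] at h ⊢
    have h4 : (3 : K) = 0 := by linear_combination h
    linear_combination -h4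
  have key : qbr (q / x) * (q * x) = q ^ 2 - 1 := by
    unfold qbr
    rw [inv_div, sub_mul]
    calc q / x * (q * x) - x / q * (q * x) = q * q * (x / x) - x * x * (q / q) := by ring
      _ = q ^ 2 - 1 := by rw [div_self hx0, div_self hq0, hxx]; ring
  intro h
  rw [h, zero_mul] at key
  exact hqq (by linear_combination -key)

variable {q w₀ ζ₀ : K}

/-- The squares of the four special tile arguments. [folklore] -/
theorem ipHypPt_sq (hq : q ^ 2 + q + 1 = 0) (hw : w₀ ^ 2 = -q) (hζ : ζ₀ ^ 2 = -q ^ 2) :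
    (ζ₀ / w₀) ^ 2 = q ∧ (q * ζ₀ / w₀) ^ 2 = 1 ∧ ((w₀ * ζ₀)⁻¹) ^ 2 = 1 ∧ ((w₀ * (q * ζ₀))⁻¹) ^ 2 = q := by
  have hq0 : q ≠ 0 := q_ne_zero_of_quad hq
  have hq3 : q ^ 3 = 1 := by linear_combination (q - 1) * hq
  have hw0 : w₀ ≠ 0 := by rintro rfl; apply hq0; linear_combination hw
  refine ⟨?_, ?_, ?_, ?_⟩
  · rw [div_pow, hζ, hw, div_eq_iff (neg_ne_zero.2 hq0)]; ring
  · rw [div_pow, mul_pow, hζ, hw, div_eq_iff (neg_ne_zero.2 hq0)]; linear_combination (-q) * hq3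
  · rw [inv_pow, mul_pow, hw, hζ, show -q * -q ^ 2 = q ^ 3 by ring, hq3, inv_one]
  · rw [inv_pow, mul_pow, mul_pow, hw, hζ, show -q * (q ^ 2 * -q ^ 2) = q ^ 3 * q ^ 2 by ring, hq3, one_mul]
    exact inv_eq_of_mul_eq_one_right (by rw [← pow_succ]; exact hq3)

/-- **All tiles off the lines `i, i+1` have weight `1/2` at `P_i`.** [cite: IkhlefPonsaing2012, §3.4] -/
theorem ipRowWeight_hypPt_of_ne (hq : q ^ 2 + q + 1 = 0) (hw : w₀ ^ 2 = -q) (h2 : (2 : K) ≠ 0) {i : ℕ}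
    (r : Fin 2) {e : Sym2 (Site 2)} {k : ℕ} (hk : (edgeTopLevel e).toNat = k) (hk0 : k ≠ 0) (hki : k ≠ i)
    (hki' : k ≠ i + 1) : ipRowWeight q w₀ (ipHypPt q w₀ ζ₀ i) r e = 1 / 2 := by
  rw [ipRowWeight_eq_of_level q w₀ _ r hk, ipHypPt_of_ne q w₀ ζ₀ hk0 hki hki']
  have harg : (if r = 0 then (1 : K) / w₀ else (w₀ * 1)⁻¹) = w₀⁻¹ := by split_ifs <;> simp
  rw [harg, ipWtA_homog hq hw h2, ipWtB_homog hq hw h2]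
  split_ifs <;> rfl

/-- **The row-`0` tiles of the lines `i, i+1` are deterministic at `P_i`**: open iff `i` is even.
[cite: IkhlefPonsaing2012, §3.4] -/
theorem ipRowWeight_hypPt_row0 (hq : q ^ 2 + q + 1 = 0) (hq1 : q ≠ 1) (hw : w₀ ^ 2 = -q)
    (hζ : ζ₀ ^ 2 = -q ^ 2) {i : ℕ} {e : Sym2 (Site 2)}
    (hk : (edgeTopLevel e).toNat = i ∨ (edgeTopLevel e).toNat = i + 1) :
    ipRowWeight q w₀ (ipHypPt q w₀ ζ₀ i) 0 e = if i % 2 = 0 then 1 else 0 := by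
  obtain ⟨h1, h2, -, -⟩ := ipHypPt_sq hq hw hζ
  rcases hk with hk | hk
  · rw [ipRowWeight_eq_of_level q w₀ _ 0 hk, ipHypPt_self]
    simp only [if_true]
    rw [ipWtA_of_sq_eq_q hq h1, ipWtB_of_sq_eq_q h1 (qbr_div_ne_zero_of_sq_eq_q hq hq1 h1)]
    rcases Nat.mod_two_eq_zero_or_one i with hi | hi <;> simp [hi]
  · rw [ipRowWeight_eq_of_level q w₀ _ 0 hk, ipHypPt_succ]
    simp only [if_true]
    rw [mul_div_assoc] at h2 ⊢
    rw [← mul_div_assoc] at h2 ⊢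
    rw [ipWtA_of_sq_eq_one h2 (qbr_div_ne_zero_of_sq_eq_one hq hq1 h2), ipWtB_of_sq_eq_one h2]
    rcases Nat.mod_two_eq_zero_or_one i with hi | hi <;> simp [hi, Nat.add_mod]

/-- **The row-`1` tiles of the lines `i, i+1` are deterministic at `P_i`**: open iff `i` is odd.
[cite: IkhlefPonsaing2012, §3.4] -/
theorem ipRowWeight_hypPt_row1 (hq : q ^ 2 + q + 1 = 0) (hq1 : q ≠ 1) (hw : w₀ ^ 2 = -q)
    (hζ : ζ₀ ^ 2 = -q ^ 2) {i : ℕ} {e : Sym2 (Site 2)}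
    (hk : (edgeTopLevel e).toNat = i ∨ (edgeTopLevel e).toNat = i + 1) :
    ipRowWeight q w₀ (ipHypPt q w₀ ζ₀ i) 1 e = if i % 2 = 0 then 0 else 1 := by
  obtain ⟨-, -, h3, h4⟩ := ipHypPt_sq hq hw hζ
  have h10 : (1 : Fin 2) ≠ 0 := by decide
  rcases hk with hk | hk
  · rw [ipRowWeight_eq_of_level q w₀ _ 1 hk, ipHypPt_self]
    simp only [h10, if_false]
    rw [ipWtA_of_sq_eq_one h3 (qbr_div_ne_zero_of_sq_eq_one hq hq1 h3), ipWtB_of_sq_eq_one h3]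
    rcases Nat.mod_two_eq_zero_or_one i with hi | hi <;> simp [hi]
  · rw [ipRowWeight_eq_of_level q w₀ _ 1 hk, ipHypPt_succ]
    simp only [h10, if_false]
    rw [ipWtA_of_sq_eq_q hq h4, ipWtB_of_sq_eq_q h4 (qbr_div_ne_zero_of_sq_eq_q hq hq1 h4)]
    rcases Nat.mod_two_eq_zero_or_one i with hi | hi <;> simp [hi, Nat.add_mod]

end HypPoint

/-! ### Patterns with an isolated site / a joined pair are inserted patterns -/

section InsertedPatterns

variable {n : ℕ}

/-- **A reflexive pattern with an isolated unflagged site `a` is `cpInsIso a` of a reflexive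
pattern.** [folklore] -/
theorem exists_cpInsIso_of_isolated {a : Fin (n + 2)} {Q : ColPattern (n + 1)} (hrefl : ∀ x, Q.1 x x = true)
    (h1 : ∀ y, y ≠ a → Q.1 a y = false) (h2 : ∀ y, y ≠ a → Q.1 y a = false) (h3 : Q.2 a = false) :
    ∃ P : ColPattern n, (∀ x, P.1 x x = true) ∧ cpInsIso a P = Q := by
  refine ⟨(fun x y => Q.1 (a.succAbove x) (a.succAbove y), fun x => Q.2 (a.succAbove x)),
    fun x => hrefl _, Prod.ext (funext fun u => funext fun v => ?_) (funext fun u => ?_)⟩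
  · rw [Bool.eq_iff_iff, cpInsIso_fst_iff]
    by_cases hu : u = a
    · subst hu
      constructor
      · rintro (rfl | ⟨x, y, hx, -, -⟩)
        · exact hrefl _
        · exact absurd hx (Fin.succAbove_ne _ _)
      · intro h
        by_contra hne
        have hva : v ≠ u := fun hv => hne (Or.inl hv.symm)
        rw [h1 v hva] at h
        exact Bool.false_ne_true h
    · obtain ⟨x, rfl⟩ := Fin.exists_succAbove_eq hu
      by_cases hv : v = a
      · subst hv
        constructor
        · rintro (h | ⟨x', y', -, hy', -⟩)
          · exact absurd h (Fin.succAbove_ne _ _)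
          · exact absurd hy' (Fin.succAbove_ne _ _)
        · intro h
          rw [h2 _ (Fin.succAbove_ne _ _)] at h
          exact absurd h Bool.false_ne_true
      · obtain ⟨y, rfl⟩ := Fin.exists_succAbove_eq hv
        constructor
        · rintro (h | ⟨x', y', hx', hy', h⟩)
          · rw [h]; exact hrefl _
          · rw [Fin.succAbove_right_inj] at hx' hy'
            subst hx'; subst hy'; exact h
        · intro h; exact Or.inr ⟨x, y, rfl, rfl, h⟩
  · rw [Bool.eq_iff_iff, cpInsIso_snd_iff]
    by_cases hu : u = a
    · subst hu
      constructor
      · rintro ⟨x, hx, -⟩; exact absurd hx (Fin.succAbove_ne _ _)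
      · intro h; rw [h3] at h; exact absurd h Bool.false_ne_true
    · obtain ⟨x, rfl⟩ := Fin.exists_succAbove_eq hu
      constructor
      · rintro ⟨x', hx', h⟩
        rw [Fin.succAbove_right_inj] at hx'
        subst hx'; exact h
      · intro h; exact ⟨x, rfl, h⟩

/-- **An equivalence pattern with class-constant flags in which `j` and `j+1` are joined is
`cpInsDup j` of a reflexive pattern.** [folklore] -/
theorem exists_cpInsDup_of_joined {j : Fin (n + 1)} {Q : ColPattern (n + 1)} (hrefl : ∀ x, Q.1 x x = true)
    (hsymm : ∀ x y, Q.1 x y = true → Q.1 y x = true)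
    (htrans : ∀ x y z, Q.1 x y = true → Q.1 y z = true → Q.1 x z = true)
    (hwall : ∀ x y, Q.1 x y = true → Q.2 x = true → Q.2 y = true) (hj : Q.1 j.castSucc j.succ = true) :
    ∃ P : ColPattern n, (∀ x, P.1 x x = true) ∧ cpInsDup j P = Q := by
  set ι : Fin (n + 1) → Fin (n + 2) := (Fin.castSucc j).succAbove with hι
  -- `ρ u = ι (predAbove j u)` is `Q`-equivalent to `u`
  have hρ : ∀ u, Q.1 (ι (j.predAbove u)) u = true ∧ Q.1 u (ι (j.predAbove u)) = true := by
    intro u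
    by_cases hu : u = Fin.castSucc j
    · subst hu
      rw [hι, predAbove_castSucc_self', Fin.succAbove_castSucc_self]
      exact ⟨hsymm _ _ hj, hj⟩
    · rw [hι, Fin.succAbove_predAbove hu]
      exact ⟨hrefl u, hrefl u⟩
  refine ⟨(fun x y => Q.1 (ι x) (ι y), fun x => Q.2 (ι x)), fun x => hrefl _,
    Prod.ext (funext fun u => funext fun v => ?_) (funext fun u => ?_)⟩
  · rw [cpInsDup_fst, Bool.eq_iff_iff]
    show Q.1 (ι (j.predAbove u)) (ι (j.predAbove v)) = true ↔ Q.1 u v = true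
    constructor
    · intro h; exact htrans _ _ _ (htrans _ _ _ (hρ u).2 h) (hρ v).1
    · intro h; exact htrans _ _ _ (htrans _ _ _ (hρ u).1 h) (hρ v).2
  · rw [cpInsDup_snd, Bool.eq_iff_iff]
    show Q.2 (ι (j.predAbove u)) = true ↔ Q.2 u = true
    exact ⟨fun h => hwall _ _ (hρ u).1 h, fun h => hwall _ _ (hρ u).2 h⟩

/-- **A new site without open edges is isolated in the update** (and flagged only if it is the wall
site of an even column). [folklore] -/
theorem colUpdate_isolated_of_no_edge {m : ℕ} (c : ℤ) (P : ColPattern m)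
    (E : Fin (m + 1) → Fin (m + 1) → Bool) (a : Fin (m + 1)) (hE : ∀ x, E x a = false) :
    (∀ y, (colUpdate m c P E).1 a y = true → y = a) ∧ (∀ y, (colUpdate m c P E).1 y a = true → y = a) ∧
      ((colUpdate m c P E).2 a = true → (c + 1) % 2 = 0 ∧ (a : ℕ) = 0) := by
  classical
  have hiso : ∀ y, ¬ updRel m P E (Sum.inr a) y ∧ ¬ updRel m P E y (Sum.inr a) := by
    rintro (x | y) <;> simp [hE]
  have hisoIff : ∀ y, Relation.EqvGen (updRel m P E) (Sum.inr a) y ↔ y = Sum.inr a := eqvGen_isolated_iff hiso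
  refine ⟨fun y h => ?_, fun y h => ?_, fun h => ?_⟩
  · rw [colUpdate_fst_iff, hisoIff, Sum.inr.injEq] at h; exact h
  · rw [colUpdate_fst_iff] at h
    have := (hisoIff _).1 (Relation.EqvGen.symm _ _ h)
    rw [Sum.inr.injEq] at this; exact this
  · rw [colUpdate_snd_iff] at h
    obtain ⟨z, hz, hw⟩ := h
    rw [hisoIff] at hz
    subst hz
    exact hw

/-- **Two open edges from one old site join their targets in the update.** [folklore] -/
theorem colUpdate_joined_of_edges {m : ℕ} (c : ℤ) (P : ColPattern m) (E : Fin (m + 1) → Fin (m + 1) → Bool)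
    {x a a' : Fin (m + 1)} (h1 : E x a = true) (h2 : E x a' = true) : (colUpdate m c P E).1 a a' = true := by
  rw [colUpdate_fst_iff]
  exact Relation.EqvGen.trans _ (Sum.inl x) _ (Relation.EqvGen.rel _ _ ((updRel_inr_inl _ _ _ _).2 h1))
    (Relation.EqvGen.rel _ _ ((updRel_inl_inr _ _ _ _).2 h2))

end InsertedPatterns

/-! ### At `P_i` the transfer matrix maps every state into the inserted states -/

section Support

variable {K : Type*} [Field K] {n : ℕ} {q w₀ ζ₀ : K}

/-- An open edge of a nonzero-weight edge set has nonzero weight; a closed one has weight `≠ 1`.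
[folklore] -/
theorem weights_of_ipTransferW_term_ne_zero {m : ℕ} {c : ℤ} {p : Sym2 (Site 2) → K} {U : Finset (Sym2 (Site 2))}
    (h : (∏ e ∈ U, p e) * ∏ e ∈ latticeLayer m c \ U, (1 - p e) ≠ 0) :
    (∀ e ∈ U, p e ≠ 0) ∧ (∀ e ∈ latticeLayer m c, e ∉ U → p e ≠ 1) := by
  obtain ⟨hU, hU'⟩ := mul_ne_zero_iff.1 h
  rw [Finset.prod_ne_zero_iff] at hU hU'
  exact ⟨hU, fun e he heU h1 => hU' e (Finset.mem_sdiff.2 ⟨he, heU⟩) (by rw [h1, sub_self])⟩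

/-- Unpacking a nonzero entry of `t`: an intermediate pattern, a row-`1` edge set with nonzero
weight, and the lumped output. [folklore] -/
theorem exists_of_ipTransferMatrixW_ne_zero {m : ℕ} {q w : K} {z : ℕ → K} {Q Q'' : ColPattern m}
    (h : ipTransferMatrixW m q w z Q Q'' ≠ 0) :
    ∃ P₁ U, U ⊆ latticeLayer m 1 ∧ lump (colUpdate m 1 P₁ (edgeFn m 1 U)) = Q'' ∧
      (∀ e ∈ U, ipRowWeight q w z 1 e ≠ 0) ∧ (∀ e ∈ latticeLayer m 1, e ∉ U → ipRowWeight q w z 1 e ≠ 1) := by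
  classical
  unfold ipTransferMatrixW at h
  obtain ⟨P₁, -, h1⟩ := Finset.exists_ne_zero_of_sum_ne_zero h
  obtain ⟨P₂, hP₂, h2⟩ := Finset.exists_ne_zero_of_sum_ne_zero h1
  have hl : lump P₂ = Q'' := (Finset.mem_filter.1 hP₂).2
  have hT1 : ipTransferW m 1 (ipRowWeight q w z 1) P₁ P₂ ≠ 0 := (mul_ne_zero_iff.1 h2).2
  unfold ipTransferW at hT1
  obtain ⟨U, hU, hU'⟩ := Finset.exists_ne_zero_of_sum_ne_zero hT1
  rw [Finset.mem_powerset] at hU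
  by_cases hcol : colUpdate m 1 P₁ (edgeFn m 1 U) = P₂
  · rw [if_pos hcol] at hU'
    obtain ⟨hw1, hw2⟩ := weights_of_ipTransferW_term_ne_zero hU'
    exact ⟨P₁, U, hU, by rw [hcol, hl], hw1, hw2⟩
  · rw [if_neg hcol] at hU'; exact absurd rfl hU'

/-- A lattice edge of layer `1` into the target `a` is one of the two edges of top levels
`2a, 2a+1`, i.e. has index pair `(a, a)` or `(a-1, a)`. [folklore] -/
theorem level_of_mem_latticeLayer_one {m : ℕ} {x a : Fin (m + 1)}
    (he : s(colSite 1 (x : ℕ), colSite (1 + 1) (a : ℕ)) ∈ latticeLayer m 1) :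
    ((x : ℕ) = a ∨ (x : ℕ) + 1 = a) ∧
      ((edgeTopLevel s(colSite 1 (x : ℕ), colSite (1 + 1) (a : ℕ))).toNat = (x : ℕ) + a + 1) := by
  rw [latticeLayer_eq_image, Finset.mem_image] at he
  obtain ⟨p, hp, hpe⟩ := he
  have hpx : p = (x, a) := mk_colSite_injective 1 hpe
  subst hpx
  rw [mem_latticeIdx_iff] at hp
  dsimp only at hp
  refine ⟨by omega, ?_⟩
  rw [edgeTopLevel_mk_colSite]; omega

/-- **At `P_i` with `i = 2b` even, `t` leads only to states of the form `cpInsIso b P`.**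
[cite: IkhlefPonsaing2012, Lemma 3.3, §3.4] -/
theorem exists_cpInsIso_of_ipTransferMatrixW_hypPt_ne_zero (hq : q ^ 2 + q + 1 = 0) (hq1 : q ≠ 1)
    (hw : w₀ ^ 2 = -q) (hζ : ζ₀ ^ 2 = -q ^ 2) (b : Fin (n + 2)) (hb : b ≠ 0)
    {Q Q'' : ColPattern (n + 1)} (h : ipTransferMatrixW (n + 1) q w₀ (ipHypPt q w₀ ζ₀ (2 * b)) Q Q'' ≠ 0) :
    ∃ P : ColPattern n, (∀ x, P.1 x x = true) ∧ cpInsIso b P = Q'' := by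
  classical
  obtain ⟨P₁, U, hU, hl, hw1, -⟩ := exists_of_ipTransferMatrixW_ne_zero h
  -- no open edge into the target `b`
  have hE : ∀ x, edgeFn (n + 1) 1 U x b = false := by
    intro x
    rw [← Bool.not_eq_true]
    intro hx
    have hxU : s(colSite 1 (x : ℕ), colSite (1 + 1) (b : ℕ)) ∈ U := by simpa [edgeFn] using hx
    obtain ⟨hxb, hlev⟩ := level_of_mem_latticeLayer_one (hU hxU)
    refine hw1 _ hxU ?_
    rw [ipRowWeight_hypPt_row1 hq hq1 hw hζ (i := 2 * b) (by rw [hlev]; omega)]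
    simp
  obtain ⟨h1, h2, h3⟩ := colUpdate_isolated_of_no_edge 1 P₁ (edgeFn (n + 1) 1 U) b hE
  set P₂ := colUpdate (n + 1) 1 P₁ (edgeFn (n + 1) 1 U) with hP₂
  have hbv : (b : ℕ) ≠ 0 := fun h => hb (Fin.ext h)
  have h3' : P₂.2 b = false := by
    rw [← Bool.not_eq_true]; intro h; exact hbv (h3 h).2
  rw [← hl]
  refine exists_cpInsIso_of_isolated (fun x => ?_) (fun y hy => ?_) (fun y hy => ?_) ?_
  · rw [lump_fst, colUpdate_fst_self, Bool.true_or]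
  · rw [lump_fst, h3', Bool.false_and, Bool.or_false, ← Bool.not_eq_true]
    exact fun h => hy (h1 y h)
  · rw [lump_fst, h3', Bool.and_false, Bool.or_false, ← Bool.not_eq_true]
    exact fun h => hy (h2 y h)
  · rw [lump_snd, h3']

/-- **At `P_i` with `i = 2j+1` odd, `t` leads only to states of the form `cpInsDup j P`.**
[cite: IkhlefPonsaing2012, Lemma 3.3, §3.4] -/
theorem exists_cpInsDup_of_ipTransferMatrixW_hypPt_ne_zero (hq : q ^ 2 + q + 1 = 0) (hq1 : q ≠ 1)
    (hw : w₀ ^ 2 = -q) (hζ : ζ₀ ^ 2 = -q ^ 2) (j : Fin (n + 1))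
    {Q Q'' : ColPattern (n + 1)} (h : ipTransferMatrixW (n + 1) q w₀ (ipHypPt q w₀ ζ₀ (2 * j + 1)) Q Q'' ≠ 0) :
    ∃ P : ColPattern n, (∀ x, P.1 x x = true) ∧ cpInsDup j P = Q'' := by
  classical
  obtain ⟨P₁, U, -, hl, -, hw2⟩ := exists_of_ipTransferMatrixW_ne_zero h
  -- the two edges from the source `j` are open
  have hmem : ∀ t : ℕ, (t = j ∨ t = j + 1) → t ≤ n + 1 →
      s(colSite 1 (j : ℕ), colSite (1 + 1) t) ∈ latticeLayer (n + 1) 1 := by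
    intro t ht htn
    rw [latticeLayer_eq_image, Finset.mem_image]
    refine ⟨(⟨j, by omega⟩, ⟨t, by omega⟩), ?_, rfl⟩
    rw [mem_latticeIdx_iff]; dsimp only; omega
  have hopen : ∀ t : ℕ, (t = j ∨ t = j + 1) → t ≤ n + 1 → s(colSite 1 (j : ℕ), colSite (1 + 1) t) ∈ U := by
    intro t ht htn
    by_contra hU
    refine hw2 _ (hmem t ht htn) hU ?_
    have hlev : (edgeTopLevel s(colSite 1 (j : ℕ), colSite (1 + 1) t)).toNat = 2 * j + 1 ∨
        (edgeTopLevel s(colSite 1 (j : ℕ), colSite (1 + 1) t)).toNat = 2 * j + 1 + 1 := by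
      rw [edgeTopLevel_mk_colSite]; omega
    rw [ipRowWeight_hypPt_row1 hq hq1 hw hζ hlev]
    simp [Nat.add_mod]
  have hj2 := j.2
  have e1 : edgeFn (n + 1) 1 U j.castSucc j.castSucc = true := by
    simpa [edgeFn] using hopen j (Or.inl rfl) (by omega)
  have e2 : edgeFn (n + 1) 1 U j.castSucc j.succ = true := by
    simpa [edgeFn] using hopen (j + 1) (Or.inr rfl) (by omega)
  have hjoin := colUpdate_joined_of_edges 1 P₁ _ e1 e2
  have hV : IsValid (1 + 1) (lump (colUpdate (n + 1) 1 P₁ (edgeFn (n + 1) 1 U))) := lump_isValid (colUpdate_isValid _ _ _)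
  rw [← hl]
  refine exists_cpInsDup_of_joined hV.refl hV.symm hV.trans hV.wall ?_
  rw [lump_fst, hjoin, Bool.true_or]

end Support

/-! ### At `P_i` the small system is at the percolation point -/

section SmallAtPoint

variable {K : Type*} [Field K] {m : ℕ} {q w₀ ζ₀ : K}

/-- Weights that agree on the layer give the same one-layer kernel. [folklore] -/
theorem ipTransferW_congr (c : ℤ) {p p' : Sym2 (Site 2) → K} (h : ∀ e ∈ latticeLayer m c, p e = p' e)
    (P P' : ColPattern m) : ipTransferW m c p P P' = ipTransferW m c p' P P' := by
  classical
  unfold ipTransferW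
  refine Finset.sum_congr rfl fun U hU => ?_
  have hU' : U ⊆ latticeLayer m c := Finset.mem_powerset.1 hU
  rw [Finset.prod_congr rfl fun e he => h e (hU' he),
    Finset.prod_congr rfl fun e he => show 1 - p e = 1 - p' e by rw [h e (Finset.mem_sdiff.1 he).1]]

/-- Weights that agree on the two layers give the same `t`. [folklore] -/
theorem ipTwoLayerW_congr' {p₀ p₁ p₀' p₁' : Sym2 (Site 2) → K} (h0 : ∀ e ∈ latticeLayer m 0, p₀ e = p₀' e)
    (h1 : ∀ e ∈ latticeLayer m 1, p₁ e = p₁' e) (Q Q' : ColPattern m) :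
    ipTwoLayerW m p₀ p₁ Q Q' = ipTwoLayerW m p₀' p₁' Q Q' := by
  unfold ipTwoLayerW
  simp only [ipTransferW_congr 0 h0, ipTransferW_congr 1 h1]

/-- `ẑ` of the special point is the all-ones sequence on positive levels. [folklore] -/
theorem zHat_ipHypPt {i k : ℕ} (hk0 : k ≠ 0) : zHat (ipHypPt q w₀ ζ₀ i) i k = 1 := by
  rw [zHat_apply]
  split_ifs with h
  · exact ipHypPt_of_ne q w₀ ζ₀ hk0 (by omega) (by omega)
  · exact ipHypPt_of_ne q w₀ ζ₀ (by omega) (by omega) (by omega)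

/-- The `ẑ`-weights at `P_i` are all `1/2`. [cite: IkhlefPonsaing2012, §3.4] -/
theorem ipRowWeight_zHat_hypPt (hq : q ^ 2 + q + 1 = 0) (hw : w₀ ^ 2 = -q) (h2 : (2 : K) ≠ 0) {i : ℕ}
    (r : Fin 2) {e : Sym2 (Site 2)} (hk0 : (edgeTopLevel e).toNat ≠ 0) :
    ipRowWeight q w₀ (zHat (ipHypPt q w₀ ζ₀ i) i) r e = 1 / 2 := by
  rw [ipRowWeight_eq_of_level q w₀ _ r rfl, zHat_ipHypPt hk0]
  have harg : (if r = 0 then (1 : K) / w₀ else (w₀ * 1)⁻¹) = w₀⁻¹ := by split_ifs <;> simp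
  rw [harg, ipWtA_homog hq hw h2, ipWtB_homog hq hw h2]
  split_ifs <;> rfl

/-- **The small transfer matrix at `ẑ(P_i)` is the percolation-point one.** [cite: IkhlefPonsaing2012, §3.4] -/
theorem ipTransferMatrixW_zHat_hypPt (hq : q ^ 2 + q + 1 = 0) (hw : w₀ ^ 2 = -q) (h2 : (2 : K) ≠ 0) (i : ℕ)
    (Q Q' : ColPattern m) :
    ipTransferMatrixW m q w₀ (zHat (ipHypPt q w₀ ζ₀ i) i) Q Q' =
      ipTwoLayerW m (fun _ => (1 / 2 : K)) (fun _ => (1 / 2 : K)) Q Q' := by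
  rw [ipTransferMatrixW_eq]
  exact ipTwoLayerW_congr'
    (fun e he => ipRowWeight_zHat_hypPt hq hw h2 0 (level_ne_zero_of_mem (Or.inl rfl) he))
    (fun e he => ipRowWeight_zHat_hypPt hq hw h2 1 (level_ne_zero_of_mem (Or.inr rfl) he)) Q Q'

end SmallAtPoint

/-! ### The fixed space of `t` at `P_i` is a line -/

section FixedLine

variable {K : Type*} [Field K] {n : ℕ}

/-- **Contraction of a fixed vector along an insertion.** If every state reachable by the kernel
`T` is `φ P` with `P` reflexive, `φ` is injective on reflexive patterns, and `T` restricted to the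
inserted states is the small kernel `T'` (`T (φ P) (φ Q') = T' P Q'` for reflexive `Q'`, and `T'`
vanishes at non-reflexive targets), then a `T`-fixed vector `v` vanishes off the inserted reflexive
states and `u P := v (φ P)` (on reflexive `P`, else `0`) is `T'`-fixed. [folklore] -/
theorem fixed_contract {φ : ColPattern n → ColPattern (n + 1)} {T : ColPattern (n + 1) → ColPattern (n + 1) → K}
    {T' : ColPattern n → ColPattern n → K}
    (hsupp : ∀ Q Q'', T Q Q'' ≠ 0 → ∃ P, (∀ x, P.1 x x = true) ∧ φ P = Q'')
    (hinj : ∀ P P', (∀ x, P.1 x x = true) → (∀ x, P'.1 x x = true) → φ P = φ P' → P = P')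
    (hT : ∀ P Q', (∀ x, P.1 x x = true) → (∀ x, Q'.1 x x = true) → T (φ P) (φ Q') = T' P Q')
    (hT' : ∀ P Q', (∃ x, Q'.1 x x = false) → T' P Q' = 0)
    {v : ColPattern (n + 1) → K} (hv : ∀ Q'', ∑ Q, v Q * T Q Q'' = v Q'') :
    (∀ Q, (¬ ∃ P, (∀ x, P.1 x x = true) ∧ φ P = Q) → v Q = 0) ∧
      ∀ Q', ∑ P, (if ∀ x, P.1 x x = true then v (φ P) else 0) * T' P Q' =
        if ∀ x, Q'.1 x x = true then v (φ Q') else 0 := by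
  classical
  set R : Finset (ColPattern n) := Finset.univ.filter (fun P => ∀ x, P.1 x x = true) with hR
  have hmemR : ∀ P, P ∈ R ↔ ∀ x, P.1 x x = true := fun P => by simp [hR]
  -- support of `v`
  have hvsupp : ∀ Q, (¬ ∃ P, (∀ x, P.1 x x = true) ∧ φ P = Q) → v Q = 0 := by
    intro Q hQ
    rw [← hv Q]
    refine Finset.sum_eq_zero fun Q₀ _ => ?_
    by_cases hT0 : T Q₀ Q = 0
    · rw [hT0, mul_zero]
    · exact absurd (hsupp Q₀ Q hT0) hQ
  -- reindexing sums against `v`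
  have hinjOn : Set.InjOn φ R := fun P hP P' hP' h =>
    hinj P P' ((hmemR P).1 (Finset.mem_coe.1 hP)) ((hmemR P').1 (Finset.mem_coe.1 hP')) h
  have hreindex : ∀ g : ColPattern (n + 1) → K, ∑ Q, v Q * g Q = ∑ P ∈ R, v (φ P) * g (φ P) := by
    intro g
    rw [← Finset.sum_image (f := fun Q => v Q * g Q) hinjOn]
    symm
    refine Finset.sum_subset (Finset.subset_univ _) fun Q _ hQ => ?_
    rw [hvsupp Q ?_, zero_mul]
    rintro ⟨P, hP, rfl⟩
    exact hQ (Finset.mem_image.2 ⟨P, (hmemR P).2 hP, rfl⟩)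
  refine ⟨hvsupp, fun Q' => ?_⟩
  -- the `T'`-sum only sees reflexive `P`
  have hsum : (∑ P, (if ∀ x, P.1 x x = true then v (φ P) else 0) * T' P Q') = ∑ P ∈ R, v (φ P) * T' P Q' := by
    rw [hR, Finset.sum_filter]
    refine Finset.sum_congr rfl fun P _ => ?_
    split_ifs <;> simp
  rw [hsum]
  by_cases hQ' : ∀ x, Q'.1 x x = true
  · rw [if_pos hQ', ← hv (φ Q'), hreindex]
    exact Finset.sum_congr rfl fun P hP => by rw [hT P Q' ((hmemR P).1 hP) hQ']
  · rw [if_neg hQ']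
    obtain ⟨x, hx⟩ := not_forall.1 hQ'
    refine Finset.sum_eq_zero fun P _ => ?_
    rw [hT' P Q' ⟨x, Bool.eq_false_iff.2 hx⟩, mul_zero]

/-- **Expansion of a fixed vector along an insertion**: under the hypotheses of `fixed_contract`, if
moreover every `T'`-fixed vector supported on reflexive patterns is a multiple of `π'`, then `v` is a
multiple of the push-forward `v₀ Q := Σ_{P reflexive, φ P = Q} π' P`. [folklore] -/
theorem fixed_line_of_contract {φ : ColPattern n → ColPattern (n + 1)}
    {T : ColPattern (n + 1) → ColPattern (n + 1) → K} {T' : ColPattern n → ColPattern n → K}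
    (hsupp : ∀ Q Q'', T Q Q'' ≠ 0 → ∃ P, (∀ x, P.1 x x = true) ∧ φ P = Q'')
    (hinj : ∀ P P', (∀ x, P.1 x x = true) → (∀ x, P'.1 x x = true) → φ P = φ P' → P = P')
    (hT : ∀ P Q', (∀ x, P.1 x x = true) → (∀ x, Q'.1 x x = true) → T (φ P) (φ Q') = T' P Q')
    (hT' : ∀ P Q', (∃ x, Q'.1 x x = false) → T' P Q' = 0) (π' : ColPattern n → K)
    (hline : ∀ u : ColPattern n → K, (∀ Q', ∑ P, u P * T' P Q' = u Q') → ∃ a : K, u = a • π')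
    {v : ColPattern (n + 1) → K} (hv : ∀ Q'', ∑ Q, v Q * T Q Q'' = v Q'') :
    ∃ a : K, v = a • fun Q => ∑ P ∈ Finset.univ.filter (fun P => (∀ x, P.1 x x = true) ∧ φ P = Q), π' P := by
  classical
  obtain ⟨hvsupp, hu⟩ := fixed_contract hsupp hinj hT hT' hv
  set u : ColPattern n → K := fun P => if ∀ x, P.1 x x = true then v (φ P) else 0 with hudef
  have hufix : ∀ Q', ∑ P, u P * T' P Q' = u Q' := hu
  obtain ⟨a, ha⟩ := hline u hufix
  refine ⟨a, funext fun Q => ?_⟩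
  simp only [Pi.smul_apply, smul_eq_mul]
  by_cases hQ : ∃ P, (∀ x, P.1 x x = true) ∧ φ P = Q
  · obtain ⟨P₀, hP₀, rfl⟩ := hQ
    -- the fibre is `{P₀}`
    have hfib : Finset.univ.filter (fun P => (∀ x, P.1 x x = true) ∧ φ P = φ P₀) = {P₀} := by
      ext P
      simp only [Finset.mem_filter, Finset.mem_univ, true_and, Finset.mem_singleton]
      constructor
      · rintro ⟨hP, h⟩; exact hinj P P₀ hP hP₀ h
      · rintro rfl; exact ⟨hP₀, rfl⟩
    rw [hfib, Finset.sum_singleton]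
    have := congrFun ha P₀
    simp only [hudef, if_pos hP₀, Pi.smul_apply, smul_eq_mul] at this
    exact this
  · rw [hvsupp Q hQ]
    have hfib : Finset.univ.filter (fun P => (∀ x, P.1 x x = true) ∧ φ P = Q) = ∅ := by
      ext P
      simp only [Finset.mem_filter, Finset.mem_univ, true_and, Finset.notMem_empty, iff_false]
      exact fun h => hQ ⟨P, h⟩
    rw [hfib, Finset.sum_empty, mul_zero]

end FixedLine

/-! ### The adjugate of `t(P_i) - 1` is nonzero -/

section PointAdjugate

open _root_.Matrix

variable {K : Type*} [Field K] {n : ℕ}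

/-- `[x] ≠ 0` when `x² = q`, `q² + q + 1 = 0`, `q ≠ 1`. [folklore] -/
theorem qbr_ne_zero_of_sq_eq_q {q x : K} (hq : q ^ 2 + q + 1 = 0) (hq1 : q ≠ 1) (hx : x ^ 2 = q) : qbr x ≠ 0 := by
  have hq0 : q ≠ 0 := q_ne_zero_of_quad hq
  have hx0 : x ≠ 0 := fun h => hq0 (by rw [← hx, h]; ring)
  intro h
  unfold qbr at h
  rw [sub_eq_zero] at h
  have h1 : x * x = 1 := by
    conv_lhs => arg 1; rw [h]
    exact inv_mul_cancel₀ hx0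
  exact hq1 (by rw [← hx, sq, h1])

variable {q w₀ ζ₀ : K}

/-- The five non-degeneracy conditions of Lemma 3.3 hold at `P_i` (even `i = 2b`). [folklore] -/
theorem hypPt_nondeg_even (hq : q ^ 2 + q + 1 = 0) (hq1 : q ≠ 1) (hw : w₀ ^ 2 = -q) (hζ : ζ₀ ^ 2 = -q ^ 2)
    (b : ℕ) :
    let z := ipHypPt q w₀ ζ₀ (2 * b)
    qbr (z (2 * b) / w₀) ≠ 0 ∧ qbr (q / (z (2 * b) / w₀)) ≠ 0 ∧ qbr (w₀ * z (2 * b + 1))⁻¹ ≠ 0 ∧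
      qbr (q / (w₀ * z (2 * b + 1))⁻¹) ≠ 0 ∧ qbr (q / (q * (w₀ * z (2 * b + 1))⁻¹)) ≠ 0 := by
  intro z
  obtain ⟨h1, -, -, h4⟩ := ipHypPt_sq hq hw hζ
  have hq0 : q ≠ 0 := q_ne_zero_of_quad hq
  have hz0 : z (2 * b) = ζ₀ := ipHypPt_self _ _ _ _
  have hz1 : z (2 * b + 1) = q * ζ₀ := ipHypPt_succ _ _ _ _
  rw [hz0, hz1]
  refine ⟨qbr_ne_zero_of_sq_eq_q hq hq1 h1, qbr_div_ne_zero_of_sq_eq_q hq hq1 h1,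
    qbr_ne_zero_of_sq_eq_q hq hq1 h4, qbr_div_ne_zero_of_sq_eq_q hq hq1 h4, ?_⟩
  have hy0 : (w₀ * (q * ζ₀))⁻¹ ≠ 0 := by
    intro h; rw [h] at h4; simp at h4; exact hq0 h4.symm
  rw [← div_div, div_self hq0, one_div, qbr_inv, neg_ne_zero]
  exact qbr_ne_zero_of_sq_eq_q hq hq1 h4

/-- The five non-degeneracy conditions of Lemma 3.3 hold at `P_i` (odd `i = 2j+1`). [folklore] -/
theorem hypPt_nondeg_odd (hq : q ^ 2 + q + 1 = 0) (hq1 : q ≠ 1) (hw : w₀ ^ 2 = -q) (hζ : ζ₀ ^ 2 = -q ^ 2)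
    (j : ℕ) :
    let z := ipHypPt q w₀ ζ₀ (2 * j + 1)
    qbr (z (2 * j + 1) / w₀) ≠ 0 ∧ qbr (q / (z (2 * j + 1) / w₀)) ≠ 0 ∧
      qbr (q / (q * (z (2 * j + 1) / w₀))) ≠ 0 ∧ qbr (w₀ * z (2 * j + 1 + 1))⁻¹ ≠ 0 ∧
      qbr (q / (w₀ * z (2 * j + 1 + 1))⁻¹) ≠ 0 := by
  intro z
  obtain ⟨h1, -, -, h4⟩ := ipHypPt_sq hq hw hζ
  have hq0 : q ≠ 0 := q_ne_zero_of_quad hq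
  have hz0 : z (2 * j + 1) = ζ₀ := ipHypPt_self _ _ _ _
  have hz1 : z (2 * j + 1 + 1) = q * ζ₀ := ipHypPt_succ _ _ _ _
  rw [hz0, hz1]
  refine ⟨qbr_ne_zero_of_sq_eq_q hq hq1 h1, qbr_div_ne_zero_of_sq_eq_q hq hq1 h1, ?_,
    qbr_ne_zero_of_sq_eq_q hq hq1 h4, qbr_div_ne_zero_of_sq_eq_q hq hq1 h4⟩
  rw [← div_div, div_self hq0, one_div, qbr_inv, neg_ne_zero]
  exact qbr_ne_zero_of_sq_eq_q hq hq1 h1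

end PointAdjugate

section ComplexPointAdjugate

open _root_.Matrix

variable {n : ℕ}

/-- **The transfer matrix at the special point `P_i`**, as a complex matrix. [cite: IkhlefPonsaing2012, §3.4] -/
noncomputable def ipTMatPt (n : ℕ) (q w₀ ζ₀ : ℂ) (i : ℕ) : Matrix (ColPattern (n + 1)) (ColPattern (n + 1)) ℂ :=
  Matrix.of fun Q Q' => ipTransferMatrixW (n + 1) q w₀ (ipHypPt q w₀ ζ₀ i) Q Q'

/-- Fixed row vectors in sum form. [folklore] -/
theorem vecMul_sub_one_eq_zero_iff {m : Type*} [Fintype m] [DecidableEq m] {R : Type*} [CommRing R]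
    (M : Matrix m m R) (x : m → R) : x ᵥ* (M - 1) = 0 ↔ ∀ j, ∑ i, x i * M i j = x j := by
  constructor
  · intro h j
    have := congrFun h j
    rwa [vecMul_sub, vecMul_one, Pi.sub_apply, Pi.zero_apply, sub_eq_zero, vecMul, dotProduct] at this
  · intro h
    funext j
    rw [vecMul_sub, vecMul_one, Pi.sub_apply, Pi.zero_apply, sub_eq_zero, vecMul, dotProduct]
    exact h j

/-- The line property downstairs, in sum form. [cite: IkhlefPonsaing2012, §3.4] -/
theorem ipTwoLayerW_half_complex_line (u : ColPattern n → ℂ)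
    (hu : ∀ Q', ∑ P, u P * ipTwoLayerW n (fun _ => (1 / 2 : ℂ)) (fun _ => (1 / 2 : ℂ)) P Q' = u Q') :
    ∃ a : ℂ, u = a • fun Q => (ipStationaryL n Q : ℂ) :=
  ipTMat0_complex_vecMul_line u ((vecMul_sub_one_eq_zero_iff _ _).2 hu)

variable {q w₀ ζ₀ : ℂ}

/-- **At `P_i` (`i = 2b` even) every fixed row vector of `t` is a multiple of the push-forward of
`π̄` along `cpInsIso b`.** [cite: IkhlefPonsaing2012, Lemma 3.3, §3.4] -/
theorem ipTMatPt_vecMul_line_even (hq : q ^ 2 + q + 1 = 0) (hw : w₀ ^ 2 = -q) (hζ : ζ₀ ^ 2 = -q ^ 2)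
    (b : Fin (n + 2)) (hb : b ≠ 0) (x : ColPattern (n + 1) → ℂ)
    (hx : x ᵥ* (ipTMatPt n q w₀ ζ₀ (2 * b) - 1) = 0) :
    ∃ a : ℂ, x = a • fun Q => ∑ P ∈ Finset.univ.filter (fun P => (∀ y, P.1 y y = true) ∧ cpInsIso b P = Q),
      (ipStationaryL n P : ℂ) := by
  have hq1 : q ≠ 1 := by rintro rfl; norm_num at hq
  have h2 : (2 : ℂ) ≠ 0 := two_ne_zero
  obtain ⟨n1, n2, n3, n4, n5⟩ := hypPt_nondeg_even hq hq1 hw hζ (b : ℕ)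
  rw [vecMul_sub_one_eq_zero_iff] at hx
  refine fixed_line_of_contract (T' := ipTwoLayerW n (fun _ => (1 / 2 : ℂ)) (fun _ => (1 / 2 : ℂ)))
    (fun Q Q'' h => exists_cpInsIso_of_ipTransferMatrixW_hypPt_ne_zero hq hq1 hw hζ b hb h)
    (fun P P' hP hP' h => cpInsIso_inj_of_refl hP hP' h) (fun P Q' _ hQ' => ?_) (fun P Q' ⟨y, hy⟩ => ?_)
    _ ipTwoLayerW_half_complex_line hx
  · show ipTransferMatrixW (n + 1) q w₀ (ipHypPt q w₀ ζ₀ (2 * b)) (cpInsIso b P) (cpInsIso b Q') = _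
    rw [ipTransferMatrixW_cpInsIso_cpInsIso hq w₀ _ b hb (ipHypPt_hyp q w₀ ζ₀ _) n1 n2 n3 n4 n5 P hQ',
      ipTransferMatrixW_zHat_hypPt hq hw h2]
  · have h0 : ipTransferMatrixW n q w₀ (zHat (ipHypPt q w₀ ζ₀ (2 * b)) (2 * b)) P Q' = 0 :=
      ipTransferMatrixW_eq_zero_of_not_refl q w₀ _ P Q' hy
    rw [ipTransferMatrixW_zHat_hypPt hq hw h2] at h0
    exact h0

/-- **At `P_i` (`i = 2j+1` odd) every fixed row vector of `t` is a multiple of the push-forward of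
`π̄` along `cpInsDup j`.** [cite: IkhlefPonsaing2012, Lemma 3.3, §3.4] -/
theorem ipTMatPt_vecMul_line_odd (hq : q ^ 2 + q + 1 = 0) (hw : w₀ ^ 2 = -q) (hζ : ζ₀ ^ 2 = -q ^ 2)
    (j : Fin (n + 1)) (x : ColPattern (n + 1) → ℂ)
    (hx : x ᵥ* (ipTMatPt n q w₀ ζ₀ (2 * j + 1) - 1) = 0) :
    ∃ a : ℂ, x = a • fun Q => ∑ P ∈ Finset.univ.filter (fun P => (∀ y, P.1 y y = true) ∧ cpInsDup j P = Q),
      (ipStationaryL n P : ℂ) := by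
  have hq1 : q ≠ 1 := by rintro rfl; norm_num at hq
  have h2 : (2 : ℂ) ≠ 0 := two_ne_zero
  obtain ⟨n1, n2, n3, n4, n5⟩ := hypPt_nondeg_odd hq hq1 hw hζ (j : ℕ)
  rw [vecMul_sub_one_eq_zero_iff] at hx
  refine fixed_line_of_contract (T' := ipTwoLayerW n (fun _ => (1 / 2 : ℂ)) (fun _ => (1 / 2 : ℂ)))
    (fun Q Q'' h => exists_cpInsDup_of_ipTransferMatrixW_hypPt_ne_zero hq hq1 hw hζ j h)
    (fun P P' _ _ h => cpInsDup_injective j h) (fun P Q' hP _ => ?_) (fun P Q' ⟨y, hy⟩ => ?_)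
    _ ipTwoLayerW_half_complex_line hx
  · show ipTransferMatrixW (n + 1) q w₀ (ipHypPt q w₀ ζ₀ (2 * j + 1)) (cpInsDup j P) (cpInsDup j Q') = _
    rw [ipTransferMatrixW_cpInsDup_cpInsDup hq w₀ _ j (ipHypPt_hyp q w₀ ζ₀ _) n1 n2 n3 n4 n5 (hP j) Q',
      ipTransferMatrixW_zHat_hypPt hq hw h2]
  · have h0 : ipTransferMatrixW n q w₀ (zHat (ipHypPt q w₀ ζ₀ (2 * j + 1)) (2 * j + 1)) P Q' = 0 :=
      ipTransferMatrixW_eq_zero_of_not_refl q w₀ _ P Q' hy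
    rw [ipTransferMatrixW_zHat_hypPt hq hw h2] at h0
    exact h0

end ComplexPointAdjugate

end Literature.Probability.Percolation
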